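import Summits.QuantumFields.BalabanUV.Beta.FP.StepLawWardGeneric
import Summits.QuantumFields.BalabanUV.Beta.HessKerConvCKPlug
import Summits.QuantumFields.BalabanUV.Beta.GAN24.KSlotAssembly
import Summits.QuantumFields.BalabanUV.Beta.GAN24.KSlotJMHolds
import Summits.QuantumFields.BalabanUV.Beta.GAN24.SlotRowsPowBase
import Summits.QuantumFields.BalabanUV.Beta.FP.PerfectRebase

/-!
# `BalabanUV.Beta.FP.RoadRebasedHoldsBm` — road «FP» for binder row D1, claim-table row BM-ROWS (owner ruling R-FP-13 (d)): THE CAUCHY ROWS AND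
# THE CLASS DATA OF THE BLOCK-MEAN CO-DRESSED RESOLVENT FAMILY, FROM ROW G-an2-4's ENTRYWISE K-SLOT ROWS BY NAME (`d = 3`, every `Lc ≥ 2`, every
# in-block root `r ∈ box (3+1) Lc`, adopted units `sfStep Lc` ∕ `smStep 3 Lc`)

HONEST DEPENDENCY (page 1, mandatory): continuum YM on T⁴ ⇐ BetaPertH ∧ nine spine estimates (0/9 proved); BetaPertH ⇐ (D1) ∧ (D4) ∧
CAP+tail; G-an2-4 gates asym, D1 and NE2/3/4.  HONEST FRAMING (cell contract, verbatim): «discharging `BetaPertH` makes Bałaban's UV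
stability UNCONDITIONAL — a real constructive-QFT result; it is NOT the continuum limit and NOT the Clay problem.»

WHAT.  The owner's generic END for the BLOCK-MEAN ROOTED family `dressBmAt hr ∘ Js⁰`
(`StepLawWardGeneric.d1Drift_dressBmAt_of_ward_symm_explicitDefect`, `RoadEndGeneric.d1Drift_dressBmAt_of_step_law_bounded`) displays, on the
K-side, (i) the `m = 1` Cauchy-currency rows `hK` ∕ `hKall` of the unit-rescaled CO-DRESSED one-step resolvents
`unitK (sf j) (sm j) (coDressKBmAt (toSite r) Lc (KInvStep Lc j))`, and (ii) the class data `hGinf : ∀ m ≥ 1, ∃ δ C, 0 < δ ∧ 0 ≤ C ∧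
Decays (KPerfOf sf sm G m) C δ` of a supplied (j, m) resolvent family `G` pinned at `m = 1` to those co-dressed resolvents (`hG1`).
THIS FILE supplies both at the adopted units, for the (j, m) block-mean members the row's text names,
  `GBm r Lc j m := coDressKBmAt (toSite r) (Lc^m) (KTot (Lc^(j+m)) (Lc^j))`
(the `m`-fold composite resolvent from level `j`, co-dressed by the block-mean axial projector kernel of blocking `Lc^m` rooted at `toSite r` — the
base-`Lc` root is a base-`Lc^m` root, gan24-p1's `SlotRowsPowBase.mem_box_pow`), from row G-an2-4's ENTRYWISE K-slot rows BY NAME: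
* §1 `GBm`, `GBm_one` (the END's pin `hG1`: `GBm r Lc j 1 = coDressKBmAt (toSite r) Lc (KInvStep Lc j)`, by `pow_one` + `KInvStep_eq_KTot`),
  `KPerfOf_GBm_one` (junction: the family's `m = 1` perfect resolvent IS asym1's block-mean constructed limit `G∞` of `HessKerCoDressedBmWall` §3∕§5);
* §2 **`bmRows_holds`** — for EVERY `m ≥ 1`: `∃ C δ cK θ, 0 < δ ∧ 0 ≤ θ ∧ θ < 1 ∧ (∀ j, Decays (unitK … (GBm r Lc j m)) C δ) ∧ (∀ k j, Decays (… (k+j) …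
  − … k …) (cK·θ^k) δ)` — gan24-p3's (j, m) rows `KSlotJMHolds.kSlotJM_holds` transported through asym1's
  `HessKerCoDressedBmWall.exists_coDressedBm_unit_rows` (blocking `Lc^m`; rate `δ/4`, constants `c·C`, `c·c_K`);
  **`decays_KPerfOf_GBm_holds`** ∕ **`hGinf_GBm_holds`** (= the END's `hGinf` binder LITERALLY, by `HessKerDressedLimit.decays_limMKerOf`) and the
  rate to the limit `decays_sub_KPerfOf_GBm_holds`;
* §3 **`exists_bm_rows_of_slots`** — the `m = 1` rows IN THE END's LITERAL SHAPE (`coDressKBmAt (toSite r) Lc (KInvStep Lc j)`), MERGED with ANY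
  stencil ∕ table Cauchy rows to one rate `θ` and one window `R` (`0 < R < δK`, `R/2 < δS`, `R < δW`): gan24-p1's K-pair `KSlotAssembly.convCKWall_holds` →
  asym1's `HessKerConvCKPlug.exists_merged_rows` (window `R < δK/4`) → `exists_coDressedBm_unit_rows` (rate `δK/4`) — the BM twin of
  `FP/RoadFromSlots.exists_limit_rows_of_slots`' K-part; **`exists_bm_limit_rows_of_slots`** adds the limit class data of the `m = 1` block-mean perfect
  resolvent `KPerfOf … (GBm r Lc) 1` and the rate to it (= the `hG`∕`hGinf`∕`hGrate` triple of asym1's `d1Drift_JsBalBmAtOf_iff_of_lim_codressedBm_unit`);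
* §4 THE TWO BLOCK-MEAN ENDs RE-READ with `sf := sfStep Lc`, `sm := smStep 3 Lc`, `G := GBm r Lc` and the K-side binders {`hsf`, `hsm`, `hG1`, `hK`, `hKall`,
  `hR`, `hRK`, `hRS`, `hRW`, `hθ0`, `hθ1`, `hGinf`} DISCHARGED: **`d1Drift_dressBmAt_of_slots_step_law_bounded`** (residual {pins `hS1`∕`hW1`, the S- and
  W-slot Cauchy rows of `Js⁰`, (STEP), (ASYMP)}) and **`d1Drift_dressBmAt_of_slots_ward_symm_explicitDefect`** (residual {pins, S-∕W-slot rows, `hSinf`,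
  `hWinf`, `hWf`, `hTsymm`, `hSDF`, `hasym`}).
* §5 (v1.1) THE REBASE IDENTIFICATION, UNCONDITIONAL: `GBm_pow_base` ∕ `unitK_GBm_pow_base` (the base-`Lc^m` one-step block-mean family IS the subsequence
  `j ↦ m·j` of the (j, m) family, exactly), `tendsto_unitK_GBm_holds`, **`KPerfOf_GBm_eq_pow_base_holds`**: `KPerfOf (sfStep Lc) (smStep 3 Lc) (GBm r Lc) m =
  KPerfOf (sfStep (Lc^m)) (smStep 3 (Lc^m)) (GBm r (Lc^m)) 1` (leaf-06's `PerfectRebase` pattern with the convergence hypothesis DISCHARGED by §2).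
NOT HERE (said plainly): any (SDF)∕`hSDF` statement about the block-mean family (the rebase identity above is the K-side INPUT such a supplier needs); the S-∕W-side class data `hSinf` ∕ `hWinf` (unchanged from the undressed road: the jets of the
block-mean family are UNDRESSED — `FP/RoadRebasedHolds` §1 for the pinned family); any row for Bałaban's objects beyond what row G-an2-4 has landed.

HONEST: composition of tree theorems BY NAME — 0 new estimates; ONE data def (`GBm`, the family the row names), 0 `def … : Prop`, nothing cited,
0 sorry.  Supplies DISPLAYED binders of ONE dressing's END; NOT hWf, NOT hTsymm, NOT hSDF, NOT hasym; 0∕4 binders of row D1 (hW, hR, D1Tel, D1Rep);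
NOT «D1 closed»; NEVER «G-an2-4 closed» (as (CONV-C) for `G_k`, `H_k`); NOT BetaPertH, NOT continuum, NOT Clay; not in print — our bookkeeping.
ABSOLUTE RULE (cell charter, verbatim): «No internally-minted statement may enter as a cited fact. Every hypothesis is either kernel-proved in this
package or a verbatim quotation of a PUBLISHED theorem with page reference. The manuscript(s) under audit are NOT citable for their own disputed
steps — they are the thing under adjudication; programme-internal (2001/route/tribunal) claims are never citable.»
Provenance: pub-balaban, unit `b2b-balaban-gan24-formalise-leaf-02` (gen 32; a G-an2-4 swarm seat acting as the row's SUPPLIER to road FP), 2026-08-20;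
claim table `HOME/b2b-balaban-beta-d1-p3/LEAVES-FP.md` row BM-ROWS; over gan24-p1's `KSlotAssembly` ∕ `SlotRowsPowBase`, gan24-p3's `KSlotJMHolds`,
asym1's `HessKerCoDressedBmWall` ∕ `HessKerConvCKPlug`, the owner's `RoadEndGeneric` ∕ `StepLawWardGeneric` BY NAME; no existing file touched.
-/

namespace Summit.QuantumFields.BalabanUV.Beta.FP.RoadRebasedHoldsBm

open Filter Topology
open Literature.MathematicalPhysics.QuantumFieldTheory.Balaban1983to89
open Literature.MathematicalPhysics.QuantumFieldTheory.Balaban1983to89.Beta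
open B12Beta (secondMoment)
open B12Normalization (stepBal)
open DressedMomentNormalisation (dressedEntry)
open ExpKernelCalculus (MKer Decays VertexFamily₂)
open PolarizationSign (WardTransversal)
open OneStepResolventKernel (Fib LocStencil JetData)
open OneStepKernelFamily (KInvStep TbalOf flipK D1Drift)
open AffineAveraging (box toSite)
open HessKerDressedLimit (limMKerOf decays_limMKerOf decays_sub_limMKerOf tendsto_of_decays_rate)
open Summit.QuantumFields.BalabanUV.Beta.HessKerDressedUnits (unitK unitS unitW)
open Summit.QuantumFields.BalabanUV.Beta.AxialDressingRooted (dressBmAt coDressKBmAt)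
open Summit.QuantumFields.BalabanUV.Beta.HessKerCoDressedBmWall (exists_coDressedBm_unit_rows)
open Summit.QuantumFields.BalabanUV.Beta.HessKerConvCKPlug (exists_merged_rows)
open Summit.QuantumFields.BalabanUV.Beta.GAN24.CombesThomas (sfStep smStep sfStep_ne_zero smStep_ne_zero)
open Summit.QuantumFields.BalabanUV.Beta.GAN24.KSlotAssembly (convCKWall_holds)
open Summit.QuantumFields.BalabanUV.Beta.GAN24.KSlotJMHolds (kSlotJM_holds)
open Summit.QuantumFields.BalabanUV.Beta.GAN24.SlotRowsPowBase (mem_box_pow)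
open Summit.QuantumFields.BalabanUV.Beta.FP.PerfectObjects (KTot KInvStep_eq_KTot)
open Summit.QuantumFields.BalabanUV.Beta.FP.PerfectObjectsT (KPerf SPerfOf WPerfOf)
open Summit.QuantumFields.BalabanUV.Beta.FP.TransportInfinityM (colOf)
open Summit.QuantumFields.BalabanUV.Beta.FP.StepDefectInherit (defect)
open Summit.QuantumFields.BalabanUV.Beta.FP.RoadEndGeneric (KPerfOf KPerfOf_one TGenOf fPerfG d1Drift_dressBmAt_of_step_law_bounded)
open Summit.QuantumFields.BalabanUV.Beta.FP.StepLawWardGeneric (d1Drift_dressBmAt_of_ward_symm_explicitDefect)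
open Summit.QuantumFields.BalabanUV.Beta.FP.PerfectRebase (sfStep_pow smStep_pow KTot_pow_base tendsto_mul_left_atTop' limMKerOf_comp_eq_of_exists_tendsto)

noncomputable section

/-! ## §1 The (j, m) block-mean co-dressed resolvent family -/

section Family

variable {d : ℕ}

/-- [our object] **THE (j, m) BLOCK-MEAN CO-DRESSED RESOLVENT FAMILY** rooted at `toSite r`: the `m`-fold composite resolvent from level `j`,
`KTot (Lc^(j+m)) (Lc^j)`, co-dressed by the block-mean axial projector kernel of blocking `Lc^m` (an2's `AxialDressingRooted.coDressKBmAt`). -/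
def GBm (r : Fin (d + 1) → ℕ) (Lc : ℕ) [NeZero Lc] (j m : ℕ) : MKer (d + 1) (Fib d) :=
  coDressKBmAt (toSite r) (Lc ^ m) (KTot (d := d) (Lc ^ (j + m)) (Lc ^ j))

/-- [our object] Unfolding. -/
theorem GBm_apply (r : Fin (d + 1) → ℕ) (Lc : ℕ) [NeZero Lc] (j m : ℕ) :
    GBm r Lc j m = coDressKBmAt (toSite r) (Lc ^ m) (KTot (d := d) (Lc ^ (j + m)) (Lc ^ j)) := rfl

/-- [our object] **THE `m = 1` MEMBER IS THE CO-DRESSED ONE-STEP RESOLVENT** — the pin `hG1` of the owner's block-mean ENDs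
(`KInvStep Lc j = KTot (Lc^(j+1)) (Lc^j)` by `rfl`, `FP.PerfectObjects.KInvStep_eq_KTot`). -/
theorem GBm_one (r : Fin (d + 1) → ℕ) (Lc : ℕ) [NeZero Lc] (j : ℕ) :
    GBm r Lc j 1 = coDressKBmAt (toSite r) Lc (KInvStep (d := d) Lc j) := by
  rw [GBm_apply, pow_one, KInvStep_eq_KTot]

/-- [our object] **JUNCTION WITH asym1's BLOCK-MEAN WALL END**: the `m = 1` perfect resolvent of the family IS the constructed limit `G∞` of
`HessKerCoDressedBmWall` §3 ∕ §5 (`limMKerOf (j ↦ unitK (sf j) (sm j) (coDressKBmAt (toSite r) Lc (KInvStep Lc j)))`), any units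
(the owner's `RoadEndGeneric.KPerfOf_one` at the pin `GBm_one`). -/
theorem KPerfOf_GBm_one (sf sm : ℕ → ℝ) (r : Fin (d + 1) → ℕ) (Lc : ℕ) [NeZero Lc] :
    KPerfOf sf sm (GBm r Lc) 1 = limMKerOf fun j => unitK (sf j) (sm j) (coDressKBmAt (toSite r) Lc (KInvStep (d := d) Lc j)) :=
  KPerfOf_one sf sm (GBm_one r Lc)

end Family

/-! ## §2 Cauchy rows and class data of the block-mean family, every `m ≥ 1` (`d = 3`) -/

section Rows

variable {Lc : ℕ} [NeZero Lc] {r : Fin (3 + 1) → ℕ}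

/-- **BM-ROWS, EVERY `m ≥ 1` — THE CAUCHY-CURRENCY ROWS OF THE UNIT-RESCALED (j, m) BLOCK-MEAN FAMILY, UNCONDITIONAL** [our proof]
(`d = 3`, `2 ≤ Lc`, `r ∈ box (3+1) Lc`): in the shape of `GAN24.CombesThomas.ConvCKWall`,
`∃ C δ cK θ, 0 < δ ∧ 0 ≤ θ ∧ θ < 1 ∧ (∀ j, Decays U_j C δ) ∧ (∀ k j, Decays (U_{k+j} − U_k) (cK·θ^k) δ)`,
`U_j := unitK (sfStep Lc j) (smStep 3 Lc j) (GBm r Lc j m)` — row G-an2-4's (j, m) entrywise rows (`KSlotJMHolds.kSlotJM_holds`) transported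
through the block-mean co-dressing at blocking `Lc^m` (`HessKerCoDressedBmWall.exists_coDressedBm_unit_rows`, root in block by `mem_box_pow`). -/
theorem bmRows_holds (hLc2 : 2 ≤ Lc) (hr : r ∈ box (3 + 1) Lc) {m : ℕ} (hm : 1 ≤ m) :
    ∃ C δ cK θ : ℝ, 0 < δ ∧ 0 ≤ θ ∧ θ < 1 ∧
      (∀ j, Decays (unitK (sfStep Lc j) (smStep 3 Lc j) (GBm r Lc j m)) C δ) ∧
      (∀ k j, Decays (unitK (sfStep Lc (k + j)) (smStep 3 Lc (k + j)) (GBm r Lc (k + j) m) -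
        unitK (sfStep Lc k) (smStep 3 Lc k) (GBm r Lc k m)) (cK * θ ^ k) δ) := by
  obtain ⟨C, δ, cK, θ, hδ, hθ0, hθ1, hK, hKall⟩ := kSlotJM_holds (Lc := Lc) hLc2 hm
  have hN : 1 ≤ Lc ^ m := Nat.one_le_pow _ _ (by omega)
  obtain ⟨c, -, hG, hGall⟩ := exists_coDressedBm_unit_rows hN (mem_box_pow hr hm) (sfStep Lc) (smStep 3 Lc) sfStep_ne_zero smStep_ne_zero
    (K := fun j => KTot (d := 3) (Lc ^ (j + m)) (Lc ^ j)) hδ hK hKall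
  exact ⟨c * C, δ / 4, c * cK, θ, by linarith, hθ0, hθ1, hG, hGall⟩

/-- **CLASS DATUM OF THE `m`-FOLD BLOCK-MEAN PERFECT RESOLVENT, UNCONDITIONAL** [our proof]: `∃ δ C, 0 < δ ∧ 0 ≤ C ∧
Decays (KPerfOf (sfStep Lc) (smStep 3 Lc) (GBm r Lc) m) C δ` (`HessKerDressedLimit.decays_limMKerOf` on `bmRows_holds`). -/
theorem decays_KPerfOf_GBm_holds (hLc2 : 2 ≤ Lc) (hr : r ∈ box (3 + 1) Lc) {m : ℕ} (hm : 1 ≤ m) :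
    ∃ δ C : ℝ, 0 < δ ∧ 0 ≤ C ∧ Decays (KPerfOf (d := 3) (sfStep Lc) (smStep 3 Lc) (GBm r Lc) m) C δ := by
  obtain ⟨C, δ, cK, θ, hδ, -, hθ1, hK, hKall⟩ := bmRows_holds hLc2 hr hm
  exact ⟨δ, C, hδ, (hK 0).nonneg (Sum.inl 0), decays_limMKerOf hK hKall hθ1⟩

/-- **THE END's BINDER `hGinf` FOR THE BLOCK-MEAN FAMILY, LITERALLY** [our proof]:
`∀ m ≥ 1, ∃ δ C, 0 < δ ∧ 0 ≤ C ∧ Decays (KPerfOf (sfStep Lc) (smStep 3 Lc) (GBm r Lc) m) C δ`. -/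
theorem hGinf_GBm_holds (hLc2 : 2 ≤ Lc) (hr : r ∈ box (3 + 1) Lc) :
    ∀ m : ℕ, 1 ≤ m → ∃ δ C : ℝ, 0 < δ ∧ 0 ≤ C ∧ Decays (KPerfOf (d := 3) (sfStep Lc) (smStep 3 Lc) (GBm r Lc) m) C δ :=
  fun _ hm => decays_KPerfOf_GBm_holds hLc2 hr hm

/-- **RATE TO THE BLOCK-MEAN PERFECT RESOLVENT, SAME CONSTANT** [our proof]: with the data of `bmRows_holds`,
`Decays (U_k − KPerfOf … (GBm r Lc) m) (cK·θ^k) δ` for every `k` (`HessKerDressedLimit.decays_sub_limMKerOf`). -/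
theorem decays_sub_KPerfOf_GBm_holds (hLc2 : 2 ≤ Lc) (hr : r ∈ box (3 + 1) Lc) {m : ℕ} (hm : 1 ≤ m) :
    ∃ C δ cK θ : ℝ, 0 < δ ∧ 0 ≤ θ ∧ θ < 1 ∧
      (∀ j, Decays (unitK (sfStep Lc j) (smStep 3 Lc j) (GBm r Lc j m)) C δ) ∧
      Decays (KPerfOf (d := 3) (sfStep Lc) (smStep 3 Lc) (GBm r Lc) m) C δ ∧
      (∀ k, Decays (unitK (sfStep Lc k) (smStep 3 Lc k) (GBm r Lc k m) - KPerfOf (d := 3) (sfStep Lc) (smStep 3 Lc) (GBm r Lc) m)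
        (cK * θ ^ k) δ) := by
  obtain ⟨C, δ, cK, θ, hδ, hθ0, hθ1, hK, hKall⟩ := bmRows_holds hLc2 hr hm
  exact ⟨C, δ, cK, θ, hδ, hθ0, hθ1, hK, decays_limMKerOf hK hKall hθ1,
    decays_sub_limMKerOf (K := fun j => unitK (sfStep Lc j) (smStep 3 Lc j) (GBm r Lc j m)) hKall hθ1⟩

end Rows

/-! ## §3 The `m = 1` rows in the END's literal shape, merged with the stencil ∕ table rows -/

section Merge

variable {Lc : ℕ} [NeZero Lc] {r : Fin (3 + 1) → ℕ}

/-- **THE `m = 1` BLOCK-MEAN K-ROWS MERGED WITH ANY STENCIL ∕ TABLE CAUCHY ROWS, UNCONDITIONAL ON THE K-SIDE** [our proof] (`d = 3`, `2 ≤ Lc`,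
`r ∈ box (3+1) Lc`): ONE rate `θ` and ONE window `R` (`0 < R < δK`, `R/2 < δS`, `R < δW`) with the rows `hK` ∕ `hKall` of the owner's block-mean ENDs
on `unitK (sfStep Lc j) (smStep 3 Lc j) (coDressKBmAt (toSite r) Lc (KInvStep Lc j))` — gan24-p1's K-pair `KSlotAssembly.convCKWall_holds`, asym1's
`HessKerConvCKPlug.exists_merged_rows` (window `R < δK/4`) and `HessKerCoDressedBmWall.exists_coDressedBm_unit_rows` (rate `δK/4`) BY NAME. -/
theorem exists_bm_rows_of_slots (hLc2 : 2 ≤ Lc) (hr : r ∈ box (3 + 1) Lc)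
    {S : ℕ → Fin (3 + 1) → (Fin (3 + 1) → ℤ) → MKer (3 + 1) (Fib 3)}
    {W : ℕ → Fin (3 + 1) → (Fin (3 + 1) → ℤ) → Fin (3 + 1) → (Fin (3 + 1) → ℤ) → MKer (3 + 1) (Fib 3)} {cS θS δS cW θW δW : ℝ}
    (hSall : ∀ k j, LocStencil (S (k + j) - S k) (cS * θS ^ k) δS) (hWall : ∀ k j, VertexFamily₂ (W (k + j) - W k) Lc (cW * θW ^ k) δW)
    (hδS : 0 < δS) (hδW : 0 < δW) (hθS0 : 0 ≤ θS) (hθS1 : θS < 1) (hθW0 : 0 ≤ θW) (hθW1 : θW < 1) :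
    ∃ C δK cK θ R : ℝ, 0 < R ∧ R < δK ∧ R / 2 < δS ∧ R < δW ∧ 0 ≤ θ ∧ θ < 1 ∧
      (∀ j, Decays (unitK (sfStep Lc j) (smStep 3 Lc j) (coDressKBmAt (toSite r) Lc (KInvStep (d := 3) Lc j))) C δK) ∧
      (∀ k j, Decays (unitK (sfStep Lc (k + j)) (smStep 3 Lc (k + j)) (coDressKBmAt (toSite r) Lc (KInvStep (d := 3) Lc (k + j))) -
        unitK (sfStep Lc k) (smStep 3 Lc k) (coDressKBmAt (toSite r) Lc (KInvStep (d := 3) Lc k))) (cK * θ ^ k) δK) ∧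
      (∀ k j, LocStencil (S (k + j) - S k) (cS * θ ^ k) δS) ∧ (∀ k j, VertexFamily₂ (W (k + j) - W k) Lc (cW * θ ^ k) δW) := by
  obtain ⟨C, δK, cK, θ, R, hR, hRK, hRS, hRW, hθ0, hθ1, hK, hKall, hSall', hWall'⟩ :=
    exists_merged_rows (Lc := Lc) (convCKWall_holds hLc2) hSall hWall hδS hδW hθS0 hθS1 hθW0 hθW1
  have hδK : 0 < δK := by linarith
  have hLc : 1 ≤ Lc := by omega
  obtain ⟨c, -, hG, hGall⟩ := exists_coDressedBm_unit_rows hLc hr (sfStep Lc) (smStep 3 Lc) sfStep_ne_zero smStep_ne_zero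
    (K := fun j => KInvStep (d := 3) Lc j) hδK hK hKall
  exact ⟨c * C, δK / 4, c * cK, θ, R, hR, hRK, hRS, hRW, hθ0, hθ1, hG, hGall, hSall', hWall'⟩

/-- **… WITH THE LIMIT CLASS DATA OF THE `m = 1` BLOCK-MEAN PERFECT RESOLVENT** [our proof]: the rows of `exists_bm_rows_of_slots` plus
`Decays (KPerfOf (sfStep Lc) (smStep 3 Lc) (GBm r Lc) 1) C δK` and the rate to it `Decays (U_j − KPerfOf … 1) (cK·θ^j) δK` (same constants; `KPerfOf_GBm_one`
+ `HessKerDressedLimit.decays_limMKerOf` ∕ `decays_sub_limMKerOf`) — the K-part of the BM twin of `RoadFromSlots.exists_limit_rows_of_slots`, i.e. the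
`hG` ∕ `hGinf` ∕ `hGrate` triple of asym1's `HessKerCoDressedBmWall.d1Drift_JsBalBmAtOf_iff_of_lim_codressedBm_unit` at the adopted units. -/
theorem exists_bm_limit_rows_of_slots (hLc2 : 2 ≤ Lc) (hr : r ∈ box (3 + 1) Lc)
    {S : ℕ → Fin (3 + 1) → (Fin (3 + 1) → ℤ) → MKer (3 + 1) (Fib 3)}
    {W : ℕ → Fin (3 + 1) → (Fin (3 + 1) → ℤ) → Fin (3 + 1) → (Fin (3 + 1) → ℤ) → MKer (3 + 1) (Fib 3)} {cS θS δS cW θW δW : ℝ}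
    (hSall : ∀ k j, LocStencil (S (k + j) - S k) (cS * θS ^ k) δS) (hWall : ∀ k j, VertexFamily₂ (W (k + j) - W k) Lc (cW * θW ^ k) δW)
    (hδS : 0 < δS) (hδW : 0 < δW) (hθS0 : 0 ≤ θS) (hθS1 : θS < 1) (hθW0 : 0 ≤ θW) (hθW1 : θW < 1) :
    ∃ C δK cK θ R : ℝ, 0 < R ∧ R < δK ∧ R / 2 < δS ∧ R < δW ∧ 0 ≤ θ ∧ θ < 1 ∧
      (∀ j, Decays (unitK (sfStep Lc j) (smStep 3 Lc j) (coDressKBmAt (toSite r) Lc (KInvStep (d := 3) Lc j))) C δK) ∧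
      Decays (KPerfOf (d := 3) (sfStep Lc) (smStep 3 Lc) (GBm r Lc) 1) C δK ∧
      (∀ j, Decays (unitK (sfStep Lc j) (smStep 3 Lc j) (coDressKBmAt (toSite r) Lc (KInvStep (d := 3) Lc j)) -
        KPerfOf (d := 3) (sfStep Lc) (smStep 3 Lc) (GBm r Lc) 1) (cK * θ ^ j) δK) ∧
      (∀ k j, LocStencil (S (k + j) - S k) (cS * θ ^ k) δS) ∧ (∀ k j, VertexFamily₂ (W (k + j) - W k) Lc (cW * θ ^ k) δW) := by
  obtain ⟨C, δK, cK, θ, R, hR, hRK, hRS, hRW, hθ0, hθ1, hK, hKall, hSall', hWall'⟩ :=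
    exists_bm_rows_of_slots (Lc := Lc) hLc2 hr hSall hWall hδS hδW hθS0 hθS1 hθW0 hθW1
  have hKinf := decays_limMKerOf hK hKall hθ1
  have hKrate := decays_sub_limMKerOf
    (K := fun j => unitK (sfStep Lc j) (smStep 3 Lc j) (coDressKBmAt (toSite r) Lc (KInvStep (d := 3) Lc j))) hKall hθ1
  rw [← KPerfOf_GBm_one (sfStep Lc) (smStep 3 Lc) r Lc] at hKinf hKrate
  exact ⟨C, δK, cK, θ, R, hR, hRK, hRS, hRW, hθ0, hθ1, hK, hKinf, hKrate, hSall', hWall'⟩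

end Merge

/-! ## §4 The owner's two block-mean ENDs with the K-side discharged -/

section End

variable {Lc : ℕ} [NeZero Lc] {r : Fin (3 + 1) → ℕ} (hr : r ∈ box (3 + 1) Lc) (Js0 : ℕ → JetData 3 Lc)
  (S : ℕ → ℕ → Fin (3 + 1) → (Fin (3 + 1) → ℤ) → MKer (3 + 1) (Fib 3))
  (Wt : ℕ → ℕ → Fin (3 + 1) → (Fin (3 + 1) → ℤ) → Fin (3 + 1) → (Fin (3 + 1) → ℤ) → MKer (3 + 1) (Fib 3))
  {Cs cS δS θS Cw cW δW θW : ℝ}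

/-- **ROAD «FP», THE BLOCK-MEAN END (bounded step-law form) WITH THE K-SIDE DISCHARGED** [our proof] (`d = 3`, `2 ≤ Lc`, in-block root `r`, adopted
units, `G := GBm r Lc`): `D1Drift Lc (dressBmAt hr ∘ Js⁰) N μ ν` ⟸ {pins `hS1`∕`hW1`, the S- and W-slot Cauchy rows of the UNDRESSED rescaled jets of
`Js⁰` (each at its own rate), (STEP) and (ASYMP) for `fPerfG`} — `RoadEndGeneric.d1Drift_dressBmAt_of_step_law_bounded` with `hsf`∕`hsm`∕`hG1`∕`hK`∕`hKall`
and the window supplied by §1 ∕ §3.  NOT «D1 closed». -/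
theorem d1Drift_dressBmAt_of_slots_step_law_bounded (hLc2 : 2 ≤ Lc)
    (hS1 : ∀ j, S j 1 = (Js0 j).S) (hW1 : ∀ j, Wt j 1 = (Js0 j).W)
    (hS : ∀ j, LocStencil (unitS (sfStep Lc j) (smStep 3 Lc j) (Js0 j).S) Cs δS)
    (hSall : ∀ k j, LocStencil (unitS (sfStep Lc (k + j)) (smStep 3 Lc (k + j)) (Js0 (k + j)).S -
      unitS (sfStep Lc k) (smStep 3 Lc k) (Js0 k).S) (cS * θS ^ k) δS)
    (hW : ∀ j, VertexFamily₂ (unitW (sfStep Lc j) (smStep 3 Lc j) (Js0 j).W) Lc Cw δW)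
    (hWall : ∀ k j, VertexFamily₂ (unitW (sfStep Lc (k + j)) (smStep 3 Lc (k + j)) (Js0 (k + j)).W -
      unitW (sfStep Lc k) (smStep 3 Lc k) (Js0 k).W) Lc (cW * θW ^ k) δW)
    (hδS : 0 < δS) (hδW : 0 < δW) (hθS0 : 0 ≤ θS) (hθS1 : θS < 1) (hθW0 : 0 ≤ θW) (hθW1 : θW < 1) (μ ν : Fin 4) {N Cg : ℝ}
    (hstep : ∀ m : ℕ, 1 ≤ m →
      fPerfG Lc (sfStep Lc) (smStep 3 Lc) (GBm r Lc) (GBm r Lc) S Wt μ ν (m + 1) =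
        fPerfG Lc (sfStep Lc) (smStep 3 Lc) (GBm r Lc) (GBm r Lc) S Wt μ ν m + fPerfG Lc (sfStep Lc) (smStep 3 Lc) (GBm r Lc) (GBm r Lc) S Wt μ ν 1)
    (hasym : ∀ m : ℕ, 1 ≤ m → |fPerfG Lc (sfStep Lc) (smStep 3 Lc) (GBm r Lc) (GBm r Lc) S Wt μ ν m - (m : ℝ) * stepBal N Lc| ≤ Cg) :
    D1Drift Lc (fun j => dressBmAt hr (Js0 j)) N μ ν := by
  obtain ⟨C, δK, cK, θ, R, hR, hRK, hRS, hRW, hθ0, hθ1, hK, hKall, hSall', hWall'⟩ :=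
    exists_bm_rows_of_slots (Lc := Lc) hLc2 hr
      (S := fun j => unitS (sfStep Lc j) (smStep 3 Lc j) (Js0 j).S) (W := fun j => unitW (sfStep Lc j) (smStep 3 Lc j) (Js0 j).W)
      hSall hWall hδS hδW hθS0 hθS1 hθW0 hθW1
  exact d1Drift_dressBmAt_of_step_law_bounded hr Js0 (sfStep Lc) (smStep 3 Lc) (GBm r Lc) S Wt sfStep_ne_zero smStep_ne_zero
    (GBm_one r Lc) hS1 hW1 hK hKall hS hSall' hW hWall' hR hRK hRS hRW hθ0 hθ1 μ ν hstep hasym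

/-- **ROAD «FP», THE BLOCK-MEAN END (Ward ∕ symmetry ∕ explicit-defect form) WITH THE K-SIDE DISCHARGED** [our proof] (`d = 3`, `2 ≤ Lc`, in-block root
`r`, adopted units, `G := GBm r Lc`): `D1Drift Lc (dressBmAt hr ∘ Js⁰) N μ ν` ⟸ EXACTLY {pins `hS1`∕`hW1`, the S- and W-slot Cauchy rows of the UNDRESSED
rescaled jets of `Js⁰` (each at its own rate), the S-∕W-side class data `hSinf`∕`hWinf` (`m ≥ 1`), **`hWf`**, **`hTsymm`**, **`hSDF`** (explicit defect),
**`hasym`**} — the owner's `StepLawWardGeneric.d1Drift_dressBmAt_of_ward_symm_explicitDefect` with the K-side binders `hsf`, `hsm`, `hG1`, `hK`, `hKall`, the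
window `hR`∕`hRK`∕`hRS`∕`hRW`∕`hθ0`∕`hθ1` and the class data `hGinf` supplied by §1–§3 BY NAME.  NOT «D1 closed»; 0∕4 row-D1 binders. -/
theorem d1Drift_dressBmAt_of_slots_ward_symm_explicitDefect (hLc2 : 2 ≤ Lc)
    (hS1 : ∀ j, S j 1 = (Js0 j).S) (hW1 : ∀ j, Wt j 1 = (Js0 j).W)
    (hS : ∀ j, LocStencil (unitS (sfStep Lc j) (smStep 3 Lc j) (Js0 j).S) Cs δS)
    (hSall : ∀ k j, LocStencil (unitS (sfStep Lc (k + j)) (smStep 3 Lc (k + j)) (Js0 (k + j)).S -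
      unitS (sfStep Lc k) (smStep 3 Lc k) (Js0 k).S) (cS * θS ^ k) δS)
    (hW : ∀ j, VertexFamily₂ (unitW (sfStep Lc j) (smStep 3 Lc j) (Js0 j).W) Lc Cw δW)
    (hWall : ∀ k j, VertexFamily₂ (unitW (sfStep Lc (k + j)) (smStep 3 Lc (k + j)) (Js0 (k + j)).W -
      unitW (sfStep Lc k) (smStep 3 Lc k) (Js0 k).W) Lc (cW * θW ^ k) δW)
    (hδS : 0 < δS) (hδW : 0 < δW) (hθS0 : 0 ≤ θS) (hθS1 : θS < 1) (hθW0 : 0 ≤ θW) (hθW1 : θW < 1)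
    (hSinf : ∀ m : ℕ, 1 ≤ m → ∃ Cs' δS' : ℝ, 0 < δS' ∧ LocStencil (SPerfOf (sfStep Lc) (smStep 3 Lc) S m) Cs' δS')
    (hWinf : ∀ m : ℕ, 1 ≤ m → ∃ Cw' δW' : ℝ, 0 < δW' ∧ VertexFamily₂ (WPerfOf (sfStep Lc) (smStep 3 Lc) Wt m) (Lc ^ m) Cw' δW')
    (hWf : WardTransversal (flipK (TGenOf Lc (KPerfOf (sfStep Lc) (smStep 3 Lc) (GBm r Lc) 1) (KPerfOf (sfStep Lc) (smStep 3 Lc) (GBm r Lc) 1)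
      (SPerfOf (sfStep Lc) (smStep 3 Lc) S 1) (WPerfOf (sfStep Lc) (smStep 3 Lc) Wt 1))))
    (hTsymm : ∀ a b t,
      TGenOf Lc (KPerfOf (sfStep Lc) (smStep 3 Lc) (GBm r Lc) 1) (KPerfOf (sfStep Lc) (smStep 3 Lc) (GBm r Lc) 1)
          (SPerfOf (sfStep Lc) (smStep 3 Lc) S 1) (WPerfOf (sfStep Lc) (smStep 3 Lc) Wt 1) a b t
        = TGenOf Lc (KPerfOf (sfStep Lc) (smStep 3 Lc) (GBm r Lc) 1) (KPerfOf (sfStep Lc) (smStep 3 Lc) (GBm r Lc) 1)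
          (SPerfOf (sfStep Lc) (smStep 3 Lc) S 1) (WPerfOf (sfStep Lc) (smStep 3 Lc) Wt 1) b a (-t))
    (μ ν : Fin 4)
    (hSDF : ∀ m : ℕ, 1 ≤ m → secondMoment (defect
      (fun m => TGenOf (Lc ^ m) (KPerfOf (sfStep Lc) (smStep 3 Lc) (GBm r Lc) m) (KPerfOf (sfStep Lc) (smStep 3 Lc) (GBm r Lc) m)
        (SPerfOf (sfStep Lc) (smStep 3 Lc) S m) (WPerfOf (sfStep Lc) (smStep 3 Lc) Wt m))
      (fun m a b z => ((Lc ^ m : ℕ) : ℝ) ^ 8 * dressedEntry (colOf (KPerf (d := 3) Lc (sfStep Lc) (smStep 3 Lc) m))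
        (TGenOf Lc (KPerfOf (sfStep Lc) (smStep 3 Lc) (GBm r Lc) 1) (KPerfOf (sfStep Lc) (smStep 3 Lc) (GBm r Lc) 1)
          (SPerfOf (sfStep Lc) (smStep 3 Lc) S 1) (WPerfOf (sfStep Lc) (smStep 3 Lc) Wt 1))
        (((Lc ^ m : ℕ) : ℤ) • z) a b) m) μ ν = 0)
    {N Cg : ℝ}
    (hasym : ∀ m : ℕ, 1 ≤ m → |fPerfG Lc (sfStep Lc) (smStep 3 Lc) (GBm r Lc) (GBm r Lc) S Wt μ ν m - (m : ℝ) * stepBal N Lc| ≤ Cg) :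
    D1Drift Lc (fun j => dressBmAt hr (Js0 j)) N μ ν := by
  obtain ⟨C, δK, cK, θ, R, hR, hRK, hRS, hRW, hθ0, hθ1, hK, hKall, hSall', hWall'⟩ :=
    exists_bm_rows_of_slots (Lc := Lc) hLc2 hr
      (S := fun j => unitS (sfStep Lc j) (smStep 3 Lc j) (Js0 j).S) (W := fun j => unitW (sfStep Lc j) (smStep 3 Lc j) (Js0 j).W)
      hSall hWall hδS hδW hθS0 hθS1 hθW0 hθW1
  exact d1Drift_dressBmAt_of_ward_symm_explicitDefect hr Js0 (sfStep Lc) (smStep 3 Lc) (GBm r Lc) S Wt hLc2 sfStep_ne_zero smStep_ne_zero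
    (GBm_one r Lc) hS1 hW1 hK hKall hS hSall' hW hWall' hR hRK hRS hRW hθ0 hθ1 (hGinf_GBm_holds hLc2 hr) hSinf hWinf hWf hTsymm μ ν hSDF hasym

end End

/-! ## §5 (v1.1) The REBASE identification: the (j, m) block-mean family along `j ↦ m·j` IS the base-`Lc^m` block-mean one-step family, and the
`m`-fold block-mean perfect resolvent IS the base-`Lc^m` one-step block-mean perfect resolvent — UNCONDITIONAL (`d = 3`, `2 ≤ Lc`, `1 ≤ m`) -/

section Rebase

variable {d : ℕ}

/-- [our object] **EXACT RE-INDEXING OF THE BLOCK-MEAN FAMILY**: the `m = 1` member at base `Lc^m`, step `j`, IS the `m`-member at base `Lc`, step `m·j`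
(same co-dressing `coDressKBmAt (toSite r) (Lc^m)`; leaf-06's `PerfectRebase.KTot_pow_base`; every `d`, `Lc ≥ 1`, `m`, `j`, `r`). -/
theorem GBm_pow_base (r : Fin (d + 1) → ℕ) (Lc : ℕ) [NeZero Lc] (m j : ℕ) : GBm r (Lc ^ m) j 1 = GBm r Lc (m * j) m := by
  rw [GBm_apply, GBm_apply, pow_one, KTot_pow_base]

/-- [our object] … in the adopted units: `unitK (sfStep (Lc^m) j) (smStep d (Lc^m) j) (GBm r (Lc^m) j 1) = unitK (sfStep Lc (m·j)) (smStep d Lc (m·j)) (GBm r Lc (m·j) m)`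
(`sfStep_pow`, `smStep_pow`) — the defining family of `KPerfOf (sfStep (Lc^m)) (smStep d (Lc^m)) (GBm r (Lc^m)) 1` IS the arithmetic SUBSEQUENCE `j ↦ m·j`
of the defining family of `KPerfOf (sfStep Lc) (smStep d Lc) (GBm r Lc) m`. -/
theorem unitK_GBm_pow_base (r : Fin (d + 1) → ℕ) (Lc : ℕ) [NeZero Lc] (m j : ℕ) :
    unitK (sfStep (Lc ^ m) j) (smStep d (Lc ^ m) j) (GBm r (Lc ^ m) j 1) = unitK (sfStep Lc (m * j)) (smStep d Lc (m * j)) (GBm r Lc (m * j) m) := by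
  rw [sfStep_pow, smStep_pow, GBm_pow_base]

/-- [our object] **UNDER ENTRYWISE CONVERGENCE (X1m-K shape, any `d`, `Lc ≥ 1`, `1 ≤ m`): the `m`-fold block-mean perfect resolvent IS the base-`Lc^m`
one-step block-mean perfect resolvent** (`PerfectRebase.limMKerOf_comp_eq_of_exists_tendsto` on the subsequence `j ↦ m·j`). -/
theorem KPerfOf_GBm_eq_pow_base_of_exists_tendsto (r : Fin (d + 1) → ℕ) (Lc : ℕ) [NeZero Lc] {m : ℕ} (hm : 1 ≤ m)
    (hconv : ∀ x y a b, ∃ L : ℝ,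
      Tendsto (fun j => unitK (sfStep Lc j) (smStep d Lc j) (GBm r Lc j m) x y a b) atTop (𝓝 L)) :
    KPerfOf (d := d) (sfStep Lc) (smStep d Lc) (GBm r Lc) m = KPerfOf (sfStep (Lc ^ m)) (smStep d (Lc ^ m)) (GBm r (Lc ^ m)) 1 := by
  have hU : (fun j => unitK (sfStep (Lc ^ m) j) (smStep d (Lc ^ m) j) (GBm r (Lc ^ m) j 1)) =
      fun j => (fun i => unitK (sfStep Lc i) (smStep d Lc i) (GBm r Lc i m)) (m * j) :=
    funext fun j => unitK_GBm_pow_base r Lc m j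
  unfold KPerfOf
  rw [hU]
  exact (limMKerOf_comp_eq_of_exists_tendsto (K := fun i => unitK (sfStep Lc i) (smStep d Lc i) (GBm r Lc i m))
    (tendsto_mul_left_atTop' hm) hconv).symm

variable {Lc : ℕ} [NeZero Lc] {r : Fin (3 + 1) → ℕ}

/-- **ENTRYWISE CONVERGENCE OF THE (j, m) BLOCK-MEAN FAMILY TO ITS PERFECT RESOLVENT, UNCONDITIONAL** [our proof] (`d = 3`, `2 ≤ Lc`, `1 ≤ m`,
`r ∈ box (3+1) Lc`): `unitK (sfStep Lc j) (smStep 3 Lc j) (GBm r Lc j m) x y a b → KPerfOf … (GBm r Lc) m x y a b` (§2's rate + `HessKerDressedLimit.tendsto_of_decays_rate`). -/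
theorem tendsto_unitK_GBm_holds (hLc2 : 2 ≤ Lc) (hr : r ∈ box (3 + 1) Lc) {m : ℕ} (hm : 1 ≤ m) (x y : Fin (3 + 1) → ℤ) (a b : Fib 3) :
    Tendsto (fun j => unitK (sfStep Lc j) (smStep 3 Lc j) (GBm r Lc j m) x y a b) atTop
      (𝓝 (KPerfOf (d := 3) (sfStep Lc) (smStep 3 Lc) (GBm r Lc) m x y a b)) := by
  obtain ⟨C, δ, cK, θ, -, hθ0, hθ1, -, -, hKrate⟩ := decays_sub_KPerfOf_GBm_holds hLc2 hr hm
  exact tendsto_of_decays_rate hKrate hθ0 hθ1 x y a b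

/-- **THE REBASE IDENTIFICATION, UNCONDITIONAL** [our proof] (`d = 3`, `2 ≤ Lc`, `1 ≤ m`, `r ∈ box (3+1) Lc`):
`KPerfOf (sfStep Lc) (smStep 3 Lc) (GBm r Lc) m = KPerfOf (sfStep (Lc^m)) (smStep 3 (Lc^m)) (GBm r (Lc^m)) 1` — the `m`-fold block-mean perfect resolvent at
base `Lc` IS the ONE-step block-mean perfect resolvent at base `Lc^m` (same root; the BM twin of leaf-06's `PerfectRebase.KPerf_eq_KPerf_pow_base_holds_of_exists_tendsto`,
here with the convergence hypothesis DISCHARGED by §2).  With `GBm_one` at base `Lc^m`: `= limMKerOf (j ↦ unitK (sfStep (Lc^m) j) (smStep 3 (Lc^m) j)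
(coDressKBmAt (toSite r) (Lc^m) (KInvStep (Lc^m) j)))` (`KPerfOf_GBm_one`) — asym1's block-mean constructed limit AT BASE `Lc^m`. -/
theorem KPerfOf_GBm_eq_pow_base_holds (hLc2 : 2 ≤ Lc) (hr : r ∈ box (3 + 1) Lc) {m : ℕ} (hm : 1 ≤ m) :
    KPerfOf (d := 3) (sfStep Lc) (smStep 3 Lc) (GBm r Lc) m = KPerfOf (sfStep (Lc ^ m)) (smStep 3 (Lc ^ m)) (GBm r (Lc ^ m)) 1 :=
  KPerfOf_GBm_eq_pow_base_of_exists_tendsto r Lc hm fun x y a b => ⟨_, tendsto_unitK_GBm_holds hLc2 hr hm x y a b⟩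

end Rebase

end

end Summit.QuantumFields.BalabanUV.Beta.FP.RoadRebasedHoldsBm
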